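import Summits.Ventures.CertifiedManyBodySolver.Theorems.TcThermcert1FreeCanonicalFugacityPullThrough
import HarnessLib

/-!
# Free canonical gas at `β·t = 8` — S5, second leg: pull-through of the CREATION operator at complex fugacity; two-leg current form

Helper file for route `TcThermcert1` (crux K1′ `ThermalStiffnessCeilingU8b8_le_7o44`, item `stmt-Ventures-24560`), crux idea
`free-canonical-b8-rung`; continuation of `Theorems/TcThermcert1FreeCanonicalFugacityPullThrough.lean` (first leg).

With `T(O) = tr(D e^{−βdΓ(h)} O)`, `E = e^{−βh}` spin-block-diagonal (spin-`σ` block `E_σ`) and a twist with `D c†_{xσ} = ζ c†_{xσ} D`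
(the two-fugacity weight `diag(z^{N↑} w^{N↓})`, §1), Gaudin's pull-through in the form `e^{−βdΓ(h)} c†_q = Σ_i E_{iq} c†_i e^{−βdΓ(h)}`
(§2, from the tree's `creation_mul_gibbsWeight_dGamma` and `e^{βh} e^{−βh} = 1`) gives for EVERY operator `B` the linear system
`(1 + ζE_σᵀ) F = R`, `F(q) = T(B c†_{qσ})`, `R(q) = T(B c†_{qσ} + c†_{qσ} B)` (§3), hence for every left inverse `G''` of `1 + ζE_σᵀ`

  `T(B c†_{qσ}) = Σ_k G''(q,k) T({B, c†_{kσ}})`   (§4)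

— for `B` odd and supported away from `k` the anticommutator vanishes, so the second leg of the current is pulled into `supp B` with the
kernel `G'' = (1 + ζE_σᵀ)⁻¹ = 1 − G_ζᵀ`. §5 combines this with the first leg (`fugacity_pullThrough_current`):

  `T(A j_σ) = i Σ_y Σ_k ( G_ζ(a,y) G''(b,k) − G_ζ(b,y) G''(a,k) ) · T({[c_{yσ}, A], c†_{kσ}})`,

the exact identity behind the card's "Wick pull-through of `j`'s two legs into `supp A = X`" (`|X|²` terms, two decaying kernels, an
even insertion `{[c_{yσ},A], c†_{kσ}} ∈ CAR(X)` of norm `≤ 4‖A‖`). NOT here: the norm control (kernel decay on the good arc, stub S4; the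
insertion bound, stub S6 = the card's named residual).

HONEST LABEL: finite-dimensional algebra; a step of a RUNG (`U = 0`, BC5-type witness for the C8 bet), reach at `U = 8` ZERO; decides
nothing about K1/K1′/`T_c`; superconductivity in the Hubbard model is NOT proved or advanced by this file beyond the rung.
-/

noncomputable section

namespace Summit.Ventures.CertifiedManyBodySolver.Theorems.TcThermcert1.FreeCanonicalB8

open NormedSpace Matrix Finset
open Literature.MathematicalPhysics.QuantumLattice
open Summit.Ventures.CertifiedManyBodySolver.Theorems.TcThermcert1.FreeGasCurrentClustering
open scoped ComplexOrder

/-! ## §1 The two-fugacity weight and the creation operators -/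

section Intertwine

variable {Λ : Type*} [LinearOrder Λ] [Fintype Λ]

/-- `diag(z^{N↑} w^{N↓}) · c†_{x↑} = z · c†_{x↑} · diag(z^{N↑} w^{N↓})` (adjoint of `fugacityDiagonal_intertwine_up` at the conjugate
fugacities). -/
theorem fugacityDiagonal_mul_creation_up {inst : DecidableEq (Finset (Orb Λ))} (z w : ℂ) (x : Λ) :
    @diagonal _ ℂ inst _ (fun s : Finset (Orb Λ) => z ^ (upPart s).card * w ^ (downPart s).card) * creation (orb x 0) =
      z • (creation (orb x 0) *
        @diagonal _ ℂ inst _ (fun s : Finset (Orb Λ) => z ^ (upPart s).card * w ^ (downPart s).card)) := by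
  have h := congrArg conjTranspose (fugacityDiagonal_intertwine_up (inst := inst) (starRingEnd ℂ z) (starRingEnd ℂ w) x)
  rw [conjTranspose_mul, conjTranspose_mul, conjTranspose_smul, diagonal_conjTranspose, annihilation_conjTranspose] at h
  have hstar : star (fun s : Finset (Orb Λ) => (starRingEnd ℂ) z ^ (upPart s).card * (starRingEnd ℂ) w ^ (downPart s).card) =
      fun s : Finset (Orb Λ) => z ^ (upPart s).card * w ^ (downPart s).card := by
    funext s
    simp only [Pi.star_apply, star_mul', star_pow, Complex.star_def, Complex.conj_conj]
  rw [hstar, Complex.star_def, Complex.conj_conj, Matrix.mul_smul] at h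
  exact h.symm

/-- `diag(z^{N↑} w^{N↓}) · c†_{x↓} = w · c†_{x↓} · diag(z^{N↑} w^{N↓})`. -/
theorem fugacityDiagonal_mul_creation_down {inst : DecidableEq (Finset (Orb Λ))} (z w : ℂ) (x : Λ) :
    @diagonal _ ℂ inst _ (fun s : Finset (Orb Λ) => z ^ (upPart s).card * w ^ (downPart s).card) * creation (orb x 1) =
      w • (creation (orb x 1) *
        @diagonal _ ℂ inst _ (fun s : Finset (Orb Λ) => z ^ (upPart s).card * w ^ (downPart s).card)) := by
  have h := congrArg conjTranspose (fugacityDiagonal_intertwine_down (inst := inst) (starRingEnd ℂ z) (starRingEnd ℂ w) x)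
  rw [conjTranspose_mul, conjTranspose_mul, conjTranspose_smul, diagonal_conjTranspose, annihilation_conjTranspose] at h
  have hstar : star (fun s : Finset (Orb Λ) => (starRingEnd ℂ) z ^ (upPart s).card * (starRingEnd ℂ) w ^ (downPart s).card) =
      fun s : Finset (Orb Λ) => z ^ (upPart s).card * w ^ (downPart s).card := by
    funext s
    simp only [Pi.star_apply, star_mul', star_pow, Complex.star_def, Complex.conj_conj]
  rw [hstar, Complex.star_def, Complex.conj_conj, Matrix.mul_smul] at h
  exact h.symm

end Intertwine

/-! ## §2 Gaudin's pull-through for the creation operator in `e^{−βh}` form -/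

section Gaudin

variable {ι : Type*} [LinearOrder ι] [Fintype ι]

/-- `e^{−βdΓ(h)} c†_p = Σ_i (e^{−βh})_{ip} · c†_i e^{−βdΓ(h)}` (the tree's `creation_mul_gibbsWeight_dGamma`, which moves `c†` to the
right with `e^{βh}`, read from right to left with `e^{βh} e^{−βh} = 1`). -/
theorem gibbsWeight_dGamma_mul_creation (β : ℝ) (h : Matrix ι ι ℂ) (p : ι) :
    gibbsWeight β (dGamma h) * creation p = ∑ i, (exp (-((β : ℂ) • h))) i p • (creation i * gibbsWeight β (dGamma h)) := by
  have hinv : exp ((β : ℂ) • h) * exp (-((β : ℂ) • h)) = 1 := by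
    rw [← Matrix.exp_add_of_commute _ _ (Commute.refl ((β : ℂ) • h)).neg_right, add_neg_cancel, exp_zero]
  have hδ : ∀ k : ι, ∑ i, (exp (-((β : ℂ) • h))) i p * (exp ((β : ℂ) • h)) k i = if k = p then 1 else 0 := by
    intro k
    rw [← Matrix.one_apply, ← hinv, Matrix.mul_apply]
    exact Finset.sum_congr rfl fun i _ => mul_comm _ _
  simp_rw [creation_mul_gibbsWeight_dGamma β h, Finset.smul_sum, smul_smul]
  rw [Finset.sum_comm]
  simp_rw [← Finset.sum_smul, hδ, ite_smul, one_smul, zero_smul, Finset.sum_ite_eq', Finset.mem_univ, if_true]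

end Gaudin

/-! ## §3 The linear system `(1 + ζE_σᵀ) F = R` for `F(q) = T(B c†_{qσ})` -/

section SecondLeg

variable {Λ : Type*} [LinearOrder Λ] [Fintype Λ]

/-- **One-step identity for the creation leg.** If `D c†_{xσ} = ζ c†_{xσ} D` for all `x` and `E = e^{−βh}` is spin-block-diagonal
with spin-`σ` block `E_σ`, then for EVERY operator `B` and site `q`:
`T(B c†_{qσ}) + ζ Σ_y E_σ(y,q) T(B c†_{yσ}) = T(B c†_{qσ} + c†_{qσ} B)`, `T(O) = tr(D e^{−βdΓ(h)} O)`. -/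
theorem fugacity_pullThrough_creation_step (β : ℝ) (h : Matrix (Orb Λ) (Orb Λ) ℂ)
    (hE : ∀ q k : Orb Λ, (ofLex q).2 ≠ (ofLex k).2 → (exp (-((β : ℂ) • h))) q k = 0) (σ : Fin 2)
    (D : Matrix (Finset (Orb Λ)) (Finset (Orb Λ)) ℂ) (ζ : ℂ)
    (hD' : ∀ x : Λ, D * creation (orb x σ) = ζ • (creation (orb x σ) * D))
    (Eσ : Matrix Λ Λ ℂ) (hEσ : ∀ x y : Λ, Eσ x y = (exp (-((β : ℂ) • h))) (orb x σ) (orb y σ))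
    (B : Matrix (Finset (Orb Λ)) (Finset (Orb Λ)) ℂ) (q : Λ) :
    (D * gibbsWeight β (dGamma h) * (B * creation (orb q σ))).trace +
        ζ * ∑ y : Λ, Eσ y q * (D * gibbsWeight β (dGamma h) * (B * creation (orb y σ))).trace =
      (D * gibbsWeight β (dGamma h) * (B * creation (orb q σ) + creation (orb q σ) * B)).trace := by
  set W := gibbsWeight β (dGamma h) with hW
  -- `tr(D W c†_q B) = ζ Σ_y E_σ(y,q) tr(D W B c†_y)`
  have key : (D * W * (creation (orb q σ) * B)).trace = ζ * ∑ y : Λ, Eσ y q * (D * W * (B * creation (orb y σ))).trace := by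
    have h1 : D * W * (creation (orb q σ) * B) = D * (W * creation (orb q σ)) * B := by simp only [Matrix.mul_assoc]
    rw [h1, hW, gibbsWeight_dGamma_mul_creation β h (orb q σ), ← hW, Finset.mul_sum, Finset.sum_mul, Matrix.trace_sum,
      sum_orb_eq_sum_sum, Finset.mul_sum]
    refine Finset.sum_congr rfl fun y _ => ?_
    rw [Finset.sum_eq_single σ]
    · rw [Matrix.mul_smul, Matrix.smul_mul, Matrix.trace_smul, smul_eq_mul, ← hEσ, ← Matrix.mul_assoc, hD' y, Matrix.smul_mul,
        Matrix.smul_mul, Matrix.trace_smul, smul_eq_mul]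
      have hc : (creation (orb y σ) * D * W * B).trace = (D * W * (B * creation (orb y σ))).trace := by
        rw [Matrix.mul_assoc, Matrix.mul_assoc, Matrix.trace_mul_comm, ← Matrix.mul_assoc, Matrix.mul_assoc]
      rw [hc]
      ring
    · intro τ _ hτ
      rw [hE (orb y τ) (orb q σ) hτ, zero_smul, Matrix.mul_zero, Matrix.zero_mul, Matrix.trace_zero]
    · intro hσ; exact absurd (Finset.mem_univ σ) hσ
  rw [Matrix.mul_add, Matrix.trace_add, key]

/-- **Resummed pull-through of the creation leg.** Under the hypotheses of `fugacity_pullThrough_creation_step`, for every left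
inverse `G''` of `1 + ζE_σᵀ` and EVERY operator `B`: `T(B c†_{qσ}) = Σ_k G''(q,k) T(B c†_{kσ} + c†_{kσ} B)`. For `B` odd and supported
away from `k` the anticommutator vanishes, so the sum localises on `supp B`. -/
theorem fugacity_pullThrough_creation (β : ℝ) (h : Matrix (Orb Λ) (Orb Λ) ℂ)
    (hE : ∀ q k : Orb Λ, (ofLex q).2 ≠ (ofLex k).2 → (exp (-((β : ℂ) • h))) q k = 0) (σ : Fin 2)
    (D : Matrix (Finset (Orb Λ)) (Finset (Orb Λ)) ℂ) (ζ : ℂ)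
    (hD' : ∀ x : Λ, D * creation (orb x σ) = ζ • (creation (orb x σ) * D))
    (Eσ : Matrix Λ Λ ℂ) (hEσ : ∀ x y : Λ, Eσ x y = (exp (-((β : ℂ) • h))) (orb x σ) (orb y σ))
    (G'' : Matrix Λ Λ ℂ) (hG'' : G'' * (1 + ζ • Eσᵀ) = 1)
    (B : Matrix (Finset (Orb Λ)) (Finset (Orb Λ)) ℂ) (q : Λ) :
    (D * gibbsWeight β (dGamma h) * (B * creation (orb q σ))).trace =
      ∑ k : Λ, G'' q k * (D * gibbsWeight β (dGamma h) * (B * creation (orb k σ) + creation (orb k σ) * B)).trace := by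
  set W := gibbsWeight β (dGamma h) with hW
  set Fv : Λ → ℂ := fun y => (D * W * (B * creation (orb y σ))).trace with hFv
  set Rv : Λ → ℂ := fun y => (D * W * (B * creation (orb y σ) + creation (orb y σ) * B)).trace with hRv
  have hvec : (1 + ζ • Eσᵀ) *ᵥ Fv = Rv := by
    funext x'
    have hx' := fugacity_pullThrough_creation_step β h hE σ D ζ hD' Eσ hEσ B x'
    rw [← hW] at hx'
    rw [Matrix.add_mulVec, Matrix.one_mulVec, Matrix.smul_mulVec, Pi.add_apply, Pi.smul_apply, smul_eq_mul]
    simp only [Matrix.mulVec, dotProduct, Matrix.transpose_apply, hFv, hRv]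
    exact hx'
  have hF : Fv = G'' *ᵥ Rv := by
    calc Fv = (G'' * (1 + ζ • Eσᵀ)) *ᵥ Fv := by rw [hG'', Matrix.one_mulVec]
      _ = G'' *ᵥ ((1 + ζ • Eσᵀ) *ᵥ Fv) := by rw [Matrix.mulVec_mulVec]
      _ = G'' *ᵥ Rv := by rw [hvec]
  have hx := congrFun hF q
  simp only [hFv, hRv, Matrix.mulVec, dotProduct] at hx
  exact hx

/-! ## §5 Both legs: the current pulled into the support of the insertion -/

/-- **Two-leg pull-through of the bond current at complex fugacity.** Under the hypotheses of `fugacity_pullThrough_current` (first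
leg, kernel `G_ζ = ζ G' E_σ` symmetric on `(a,b)`) and `fugacity_pullThrough_creation` (second leg, kernel `G''`, `G''(1 + ζE_σᵀ) = 1`):
`T(A j_σ) = i Σ_y Σ_k ( G_ζ(a,y) G''(b,k) − G_ζ(b,y) G''(a,k) ) · T( [c_{yσ},A] c†_{kσ} + c†_{kσ} [c_{yσ},A] )`.
For `A` even and supported in `X`, only `y, k ∈ X` contribute and the insertion `{[c_{yσ},A], c†_{kσ}}` is even, in `CAR(X)`, of norm
`≤ 4‖A‖`. -/
theorem fugacity_pullThrough_current_twoLeg (β : ℝ) (h : Matrix (Orb Λ) (Orb Λ) ℂ)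
    (hE : ∀ q k : Orb Λ, (ofLex q).2 ≠ (ofLex k).2 → (exp (-((β : ℂ) • h))) q k = 0) (σ : Fin 2)
    (D : Matrix (Finset (Orb Λ)) (Finset (Orb Λ)) ℂ) (ζ : ℂ)
    (hD : ∀ x : Λ, (ζ • D) * annihilation (orb x σ) = annihilation (orb x σ) * D)
    (hD' : ∀ x : Λ, D * creation (orb x σ) = ζ • (creation (orb x σ) * D))
    (Eσ : Matrix Λ Λ ℂ) (hEσ : ∀ x y : Λ, Eσ x y = (exp (-((β : ℂ) • h))) (orb x σ) (orb y σ))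
    (G' : Matrix Λ Λ ℂ) (hG' : G' * (1 + ζ • Eσ) = 1) (G'' : Matrix Λ Λ ℂ) (hG'' : G'' * (1 + ζ • Eσᵀ) = 1)
    (A : Matrix (Finset (Orb Λ)) (Finset (Orb Λ)) ℂ) (a b : Λ)
    (hsymm : (ζ • (G' * Eσ)) a b = (ζ • (G' * Eσ)) b a) :
    (D * gibbsWeight β (dGamma h) *
        (A * ((-Complex.I) • (creation (orb a σ) * annihilation (orb b σ)) + Complex.I • (creation (orb b σ) * annihilation (orb a σ))))).trace =
      Complex.I * ∑ y : Λ, ∑ k : Λ, ((ζ • (G' * Eσ)) a y * G'' b k - (ζ • (G' * Eσ)) b y * G'' a k) *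
        (D * gibbsWeight β (dGamma h) *
          ((annihilation (orb y σ) * A - A * annihilation (orb y σ)) * creation (orb k σ) +
            creation (orb k σ) * (annihilation (orb y σ) * A - A * annihilation (orb y σ)))).trace := by
  rw [fugacity_pullThrough_current β h hE σ D ζ hD Eσ hEσ G' hG' A a b hsymm]
  congr 1
  refine Finset.sum_congr rfl fun y _ => ?_
  rw [fugacity_pullThrough_creation β h hE σ D ζ hD' Eσ hEσ G'' hG'' (annihilation (orb y σ) * A - A * annihilation (orb y σ)) b,
    fugacity_pullThrough_creation β h hE σ D ζ hD' Eσ hEσ G'' hG'' (annihilation (orb y σ) * A - A * annihilation (orb y σ)) a,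
    Finset.mul_sum, Finset.mul_sum, ← Finset.sum_sub_distrib]
  refine Finset.sum_congr rfl fun k _ => ?_
  ring

end SecondLeg

end Summit.Ventures.CertifiedManyBodySolver.Theorems.TcThermcert1.FreeCanonicalB8

end
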